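import Mathlib
import HarnessLib
import Summits.HubbardSuperconductivity.HubbardSuperconductivity.Theorems.KLProgrammeKLRegimeEngineV8DefsG7

/-!
# K3 ENGINE package, `G`-level v8 (k3c3-p2 g7; plan g17 (R47f) token #15): the FLOW-SCALE (E4)ₙ package `(klE4TF, klE4UF)` and
# `klEngGeo8 := klEngGeo7.raiseE4 klE4TF`

WHY (located risk «(b)-E4@n≥1», KL STATUS 2026-08-27 14:05Z; ruling (R47f)).  Stub (b) conjunct 3 of the engine-flow child reads
`EngineFirstMoments L M G P Q β U μ (K_n) n` with `G.cE4 = klEngGeo7.cE4 = max (max 2^10 klE4T) klE4T6` — a numeral and two SCALE-0 admissibility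
witnesses.  Every supply route at `n ≥ 1` ends in an inexplicit G-level constant (the level-`n` weighted torus sums of the sector functions), so the
`cE4` slot must absorb a flow-scale witness exactly as `klEngGeo7` absorbed `klE4T6` (the #7 precedent one level up):

* §1 **`E4FlowAt E u`** — «`(E, u)` is an admissible (E4)ₙ package at the inductive scales»: for EVERY well-formed `G` with `E ≤ G.cE4` and EVERY
  well-formed `P`, `R`, `Q` (fully `Q`-generic — this subsumes plan g17's device `∀ r ≥ Q₇.CR, Q := Q₇.withCR r` and survives any later `Q`-re-key),
  under the binders of the registered stub (b) with the `U`-threshold replaced by the package's own `U ≤ u G P R Q cc` (it may fold `klEngU₀9`/`klEngU₀10`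
  and whatever smallness the witness needs; `U₀` is chosen after `G, P, R, Q, c` in `EngineP4`, so this is slot-legal), the history at the SAME `(G, Q)`
  and the admissibility of the flow frame: `EngineFirstMoments L M G P Q β U μ (K_n) n` (`1 ≤ n ≤ nScales β + 1`, KL regime).  The v2 stub (b) at
  `G := klEngGeo8`, `Q := klEngQ8 P R`, `U ≤ klEngU₀10 P R cc ≤ klE4UF klEngGeo8 P R (klEngQ8 P R) cc` is an instance (no cycle: `klE4Pack` is a CLOSED term,
  read by `klEngGeo8` and by `klEngU₀10`'s extra `min` entry only).  **`klE4Pack`** (ONE classical `if` over the pair, default `(0, 1)`), `klE4TF := klE4Pack.1`,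
  `klE4UF := klE4Pack.2`, `klE4TF_nonneg`, `klE4UF_pos`, `e4FlowAt_klE4Pack` (choose_spec), `E4FlowAt.mono`;
* §2 **`klEngGeo8 := klEngGeo7.raiseE4 klE4TF`**, `klEngGeo8_wf`, `rfl` rows, `klE4TF_le_klEngGeo8_cE4`, `klEngGeo7_cE4_le_klEngGeo8_cE4` (so `klE4T6`, `klE4T`
  ride), the instantiated slot doors `…_klEngGeo8_iff` / `…_klEngGeo8_of_klEngGeo7` / `engineBoundsAtV17F2_klEngGeo8_iff_of_E4`, and the consumer forms `engineFirstMoments_flow_of_e4FlowAt` / **`engineFirstMoments_flow_klEngGeo8`**.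
The WITNESS `E4FlowAt E u` for a concrete `(E, u)` is NOT here: it is W3's output (k3c3-p2, after the tower's weighted per-tuple export).
Definitions with bodies + order lemmas; nothing about the model is asserted; nothing asserts superconductivity.
-/

noncomputable section


namespace Summit.HubbardSuperconductivity.HubbardSuperconductivity.Theorems.EngineV8

set_option linter.dupNamespace false -- summit = problem name (single-conjunct summit), D-0017

open Real Finset Literature.MathematicalPhysics.QuantumLattice Literature.Probability.LatticeModels
open Summit.HubbardSuperconductivity.HubbardSuperconductivity.Theorems.KLRegimeSplit
open Summit.HubbardSuperconductivity.HubbardSuperconductivity.Theorems.KLProgrammeLegKernels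
open Summit.HubbardSuperconductivity.HubbardSuperconductivity.Theorems.DispersionFlow

/-! ## §1 The admissibility predicate `E4FlowAt` and the deferred package -/

/-- **`E4FlowAt E u`** — «`(E, u)` is an admissible (E4)ₙ package at the inductive scales of the engine-flow child»: for every well-formed `G` with
`E ≤ G.cE4`, every well-formed `P`, `R`, `Q` and `0 < cc ≤ klEngC₃6 P R`, under `U ≤ u G P R Q cc`, the `β`-window, the volume thresholds, the regime, the
history `HistP klPredsV17F2 L M G P Q R β U μ 0 n` at the SAME `(G, Q)` and the admissibility of the flow frame,
`EngineFirstMoments L M G P Q β U μ (klFlowFrameU L M β U μ n) n` (`1 ≤ n ≤ nScales β + 1`).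
WITNESS SHAPE: `E` is bound before everything — an ABSOLUTE constant; every `G`-, `P`-, `R`-, `Q`- or `cc`-dependent part of a first-moment bound goes
under the threshold `u G P R Q cc` (or into the `Q.cE4·|U|` term of the clause), never into `E`. -/
def E4FlowAt (E : ℝ) (u : GeoConsts → SplitConsts → RenConsts → EngConsts → ℝ → ℝ) : Prop :=
  ∀ (G : GeoConsts), G.WF → E ≤ G.cE4 →
    ∀ (P : SplitConsts) (R : RenConsts) (Q : EngConsts) (cc : ℝ), P.WF → R.WF2 → Q.WF → 0 < cc → cc ≤ klEngC₃6 P R →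
    ∀ μ ∈ klWindowC, ∀ U : ℝ, 0 < U → U ≤ u G P R Q cc →
    ∀ β : ℝ, klBetaMin ≤ β → β ≤ Real.exp (cc / U ^ 2) →
    ∀ (L M : ℕ) [NeZero L] [NeZero M], klEngL₃ β U ≤ L → klEngM₃ β U L ≤ M →
    ∀ n : ℕ, 1 ≤ n → n ≤ nScales β + 1 → IsKLRegime U cc (-(n : ℤ)) →
      HistP klPredsV17F2 L M G P Q R β U μ 0 n →
        FrameOK R U (nScales β) μ (klFlowFrameU L M β U μ n) →
          EngineFirstMoments L M G P Q β U μ (klFlowFrameU L M β U μ n) n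

/-- A larger constant and a smaller threshold are still admissible. -/
theorem E4FlowAt.mono {E E' : ℝ} {u u' : GeoConsts → SplitConsts → RenConsts → EngConsts → ℝ → ℝ} (h : E4FlowAt E u) (hEE' : E ≤ E')
    (huu' : ∀ G P R Q cc, u' G P R Q cc ≤ u G P R Q cc) : E4FlowAt E' u' :=
  fun G hG hE' P R Q cc hP hR hQ hcc hcc6 μ hμ U hU hUu =>
    h G hG (hEE'.trans hE') P R Q cc hP hR hQ hcc hcc6 μ hμ U hU (hUu.trans (huu' G P R Q cc))

open Classical in
/-- **`klE4Pack`** — THE flow-scale (E4)ₙ package of the engine: an admissible pair `(E, u)` with `0 ≤ E` and `u > 0` pointwise when one exists,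
`(0, 1)` otherwise (ONE closed term for both components, so they come from the same witness). -/
def klE4Pack : ℝ × (GeoConsts → SplitConsts → RenConsts → EngConsts → ℝ → ℝ) :=
  if h : (∃ Eu : ℝ × (GeoConsts → SplitConsts → RenConsts → EngConsts → ℝ → ℝ),
      0 ≤ Eu.1 ∧ (∀ G P R Q cc, 0 < Eu.2 G P R Q cc) ∧ E4FlowAt Eu.1 Eu.2) then Classical.choose h
  else (0, fun _ _ _ _ _ => 1)

/-- **`klE4TF`** — the flow-scale (E4)ₙ constant (enters the `G`-package as `cE4 := max klEngGeo7.cE4 klE4TF`). -/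
def klE4TF : ℝ := klE4Pack.1

/-- **`klE4UF G P R Q cc`** — the flow-scale (E4)ₙ threshold (enters `klEngU₀10 P R cc` as an extra `min` entry, read at `(klEngGeo8, klEngQ8 P R)`). -/
def klE4UF : GeoConsts → SplitConsts → RenConsts → EngConsts → ℝ → ℝ := klE4Pack.2

/-- `0 ≤ klE4TF`. -/
theorem klE4TF_nonneg : 0 ≤ klE4TF := by
  classical
  unfold klE4TF klE4Pack
  split_ifs with h
  · exact (Classical.choose_spec h).1
  · exact le_rfl

/-- `0 < klE4UF G P R Q cc`. -/
theorem klE4UF_pos (G : GeoConsts) (P : SplitConsts) (R : RenConsts) (Q : EngConsts) (cc : ℝ) : 0 < klE4UF G P R Q cc := by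
  classical
  unfold klE4UF klE4Pack
  split_ifs with h
  · exact (Classical.choose_spec h).2.1 G P R Q cc
  · exact one_pos

/-- **`(klE4TF, klE4UF)` is admissible as soon as any package is** (the form in which W3's witness theorem is consumed). -/
theorem e4FlowAt_klE4Pack {E : ℝ} {u : GeoConsts → SplitConsts → RenConsts → EngConsts → ℝ → ℝ} (hE0 : 0 ≤ E)
    (hu : ∀ G P R Q cc, 0 < u G P R Q cc) (hE : E4FlowAt E u) : E4FlowAt klE4TF klE4UF := by
  classical
  have h : ∃ Eu : ℝ × (GeoConsts → SplitConsts → RenConsts → EngConsts → ℝ → ℝ),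
      0 ≤ Eu.1 ∧ (∀ G P R Q cc, 0 < Eu.2 G P R Q cc) ∧ E4FlowAt Eu.1 Eu.2 := ⟨(E, u), hE0, hu, hE⟩
  have hp : klE4Pack = Classical.choose h := by unfold klE4Pack; exact dif_pos h
  have h1 : klE4TF = (Classical.choose h).1 := by unfold klE4TF; rw [hp]
  have h2 : klE4UF = (Classical.choose h).2 := by unfold klE4UF; rw [hp]
  rw [h1, h2]
  exact (Classical.choose_spec h).2.2

/-! ## §2 The package `klEngGeo8` -/

/-- **`klEngGeo8` — the engine-flow package's absolute constants `G`, v8**: `klEngGeo7` with `cE4 := max klEngGeo7.cE4 klE4TF`, NOTHING else moved. -/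
def klEngGeo8 : GeoConsts := klEngGeo7.raiseE4 klE4TF

/-- `klEngGeo8 = klEngGeo7.raiseE4 klE4TF` (`rfl`; the form the `_raiseE4` doors consume). -/
theorem klEngGeo8_eq : klEngGeo8 = klEngGeo7.raiseE4 klE4TF := rfl

/-- `klEngGeo8` is well formed. -/
theorem klEngGeo8_wf : klEngGeo8.WF := GeoConsts.raiseE4_wf klEngGeo7_wf _

/-- `klEngGeo8.cE4 = max klEngGeo7.cE4 klE4TF`. -/
theorem klEngGeo8_cE4 : klEngGeo8.cE4 = max klEngGeo7.cE4 klE4TF := rfl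

/-- `klE4TF ≤ klEngGeo8.cE4` (what the (E4)ₙ witness's consumer needs). -/
theorem klE4TF_le_klEngGeo8_cE4 : klE4TF ≤ klEngGeo8.cE4 := le_max_right _ _

/-- `klEngGeo7.cE4 ≤ klEngGeo8.cE4` (monotone lift of every (E4) clause proved at `klEngGeo7`). -/
theorem klEngGeo7_cE4_le_klEngGeo8_cE4 : klEngGeo7.cE4 ≤ klEngGeo8.cE4 := le_max_left _ _

/-- `klE4T6 ≤ klEngGeo8.cE4` (the scale-`0` (E4)₀ constant rides). -/
theorem klE4T6_le_klEngGeo8_cE4 : klE4T6 ≤ klEngGeo8.cE4 := klE4T6_le_klEngGeo7_cE4.trans klEngGeo7_cE4_le_klEngGeo8_cE4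

/-- `klE4T ≤ klEngGeo8.cE4`. -/
theorem klE4T_le_klEngGeo8_cE4 : klE4T ≤ klEngGeo8.cE4 := klE4T_le_klEngGeo7_cE4.trans klEngGeo7_cE4_le_klEngGeo8_cE4

/-- untouched field `CF`. -/
theorem klEngGeo8_CF : klEngGeo8.CF = klEngGeo7.CF := rfl
/-- `klIsoT ^ 4 ≤ klEngGeo8.CF` (rides from v7). -/
theorem klIsoT_pow_four_le_klEngGeo8_CF : klIsoT ^ 4 ≤ klEngGeo8.CF := klIsoT_pow_four_le_klEngGeo7_CF
/-- untouched field `S`. -/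
theorem klEngGeo8_S : klEngGeo8.S = klEngGeo7.S := rfl
/-- `klS6 j ≤ klEngGeo8.S j` (rides from v7). -/
theorem klS6_le_klEngGeo8_S (j : ℕ) : klS6 j ≤ klEngGeo8.S j := klS6_le_klEngGeo7_S j
/-- untouched field `SL`. -/
theorem klEngGeo8_SL : klEngGeo8.SL = klEngGeo7.SL := rfl
/-- untouched field `Bf`. -/
theorem klEngGeo8_Bf : klEngGeo8.Bf = klEngGeo7.Bf := rfl
/-- untouched field `bhi`. -/
theorem klEngGeo8_bhi : klEngGeo8.bhi = klEngGeo7.bhi := rfl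
/-- untouched field `blo`. -/
theorem klEngGeo8_blo : klEngGeo8.blo = klEngGeo7.blo := rfl
/-- untouched field `ppGain`. -/
theorem klEngGeo8_ppGain : klEngGeo8.ppGain = klEngGeo7.ppGain := rfl
/-- untouched field `phGain`. -/
theorem klEngGeo8_phGain : klEngGeo8.phGain = klEngGeo7.phGain := rfl
/-- untouched field `aplus`. -/
theorem klEngGeo8_aplus : klEngGeo8.aplus = klEngGeo7.aplus := rfl
/-- untouched field `ζ`. -/
theorem klEngGeo8_ζ : klEngGeo8.ζ = klEngGeo7.ζ := rfl
/-- untouched field `Z`. -/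
theorem klEngGeo8_Z : klEngGeo8.Z = klEngGeo7.Z := rfl
/-- untouched field `cloc`. -/
theorem klEngGeo8_cloc : klEngGeo8.cloc = klEngGeo7.cloc := rfl
/-- untouched field `θ`. -/
theorem klEngGeo8_θ : klEngGeo8.θ = klEngGeo7.θ := rfl
/-- untouched field `a`. -/
theorem klEngGeo8_a : klEngGeo8.a = klEngGeo7.a := rfl
/-- untouched field `atop`. -/
theorem klEngGeo8_atop : klEngGeo8.atop = klEngGeo7.atop := rfl
/-- untouched field `abot`. -/
theorem klEngGeo8_abot : klEngGeo8.abot = klEngGeo7.abot := rfl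

section SlotDoors

variable {L M : ℕ} [NeZero L] [NeZero M] {P : SplitConsts} {Q : EngConsts} {R : RenConsts} {β U μ : ℝ} {K : TrigPolyC4v} {n : ℕ}

/-- `thermalBar` does not read `cE4`. -/
theorem thermalBar_klEngGeo8 (P : SplitConsts) (U β : ℝ) (n : ℕ) : thermalBar klEngGeo8 P U β n = thermalBar klEngGeo7 P U β n := rfl

/-- (E2-F2) at `klEngGeo8` iff at `klEngGeo7`. -/
theorem pairLadderStepAtV17F2_klEngGeo8_iff :
    PairLadderStepAtV17F2 L M klEngGeo8 P Q β U μ n ↔ PairLadderStepAtV17F2 L M klEngGeo7 P Q β U μ n :=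
  Iff.rfl
/-- (E2″-F) at `klEngGeo8` iff at `klEngGeo7`. -/
theorem pairValueIncrementAtV17F_klEngGeo8_iff :
    PairValueIncrementAtV17F L M klEngGeo8 P Q β U μ n ↔ PairValueIncrementAtV17F L M klEngGeo7 P Q β U μ n :=
  Iff.rfl
/-- (E2′-F) at `klEngGeo8` iff at `klEngGeo7`. -/
theorem quarticValueIncrementAtV17F_klEngGeo8_iff :
    QuarticValueIncrementAtV17F L M klEngGeo8 P Q β U μ n ↔ QuarticValueIncrementAtV17F L M klEngGeo7 P Q β U μ n :=
  Iff.rfl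
/-- (E2′-F UV) at `klEngGeo8` iff at `klEngGeo7`. -/
theorem quarticValueUVAtV17F_klEngGeo8_iff :
    QuarticValueUVAtV17F L M klEngGeo8 P Q β U μ n ↔ QuarticValueUVAtV17F L M klEngGeo7 P Q β U μ n :=
  Iff.rfl
/-- (E5-F) at `klEngGeo8` iff at `klEngGeo7`. -/
theorem isoTupleL1AtV17F_klEngGeo8_iff :
    IsoTupleL1AtV17F L M klEngGeo8 P β U μ n ↔ IsoTupleL1AtV17F L M klEngGeo7 P β U μ n :=
  Iff.rfl
/-- (E3a-F) reading jets at `klEngGeo8` iff at `klEngGeo7`. -/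
theorem twoLegReadJetsF_klEngGeo8_iff :
    TwoLegReadJetsF L M klEngGeo8 Q β U μ n ↔ TwoLegReadJetsF L M klEngGeo7 Q β U μ n :=
  Iff.rfl
/-- child 1's slot at `klEngGeo8` iff at `klEngGeo7`. -/
theorem betaSplitAtV17F_klEngGeo8_iff :
    BetaSplitAtV17F L M klEngGeo8 P Q β U μ n ↔ BetaSplitAtV17F L M klEngGeo7 P Q β U μ n :=
  Iff.rfl

/-- (E4) lifts from `klEngGeo7` to `klEngGeo8` (`0 ≤ P.Klam`). -/
theorem engineFirstMoments_klEngGeo8_of_klEngGeo7 (hK : 0 ≤ P.Klam) (h : EngineFirstMoments L M klEngGeo7 P Q β U μ K n) :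
    EngineFirstMoments L M klEngGeo8 P Q β U μ K n :=
  engineFirstMoments_raiseE4_of klE4TF hK h

/-- The engine slot lifts from `klEngGeo7` to `klEngGeo8` (`0 ≤ P.Klam`) — the (a)-closer's lift under token #15. -/
theorem engineBoundsAtV17F2_klEngGeo8_of_klEngGeo7 (hK : 0 ≤ P.Klam) (h : EngineBoundsAtV17F2 L M klEngGeo7 P Q β U μ n) :
    EngineBoundsAtV17F2 L M klEngGeo8 P Q β U μ n :=
  engineBoundsAtV17F2_raiseE4_of klE4TF hK h

/-- **What a `klEngGeo8` engine slot gives a `klEngGeo7`-keyed consumer**: every conjunct except (E4) verbatim at `klEngGeo7`, and (E4) at `klEngGeo8`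
(so every v1 closer that does not READ the history's (E4) clauses re-keys under token #15 by this door — none does, finding «E4-READER»). -/
theorem engineBoundsAtV17F2_klEngGeo8_iff_of_E4 :
    EngineBoundsAtV17F2 L M klEngGeo8 P Q β U μ n ↔
      (SelfEnergySymmetric L M β U μ (klFlowFrameU L M β U μ n) n ∧ KernelNormsV4 L M P Q β U μ (klFlowFrameU L M β U μ n) n ∧
        PairLadderStepAtV17F2 L M klEngGeo7 P Q β U μ n ∧ PairValueIncrementAtV17F L M klEngGeo7 P Q β U μ n ∧
          QuarticValueIncrementAtV17F L M klEngGeo7 P Q β U μ n ∧ QuarticValueUVAtV17F L M klEngGeo7 P Q β U μ n ∧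
            EngineFirstMoments L M klEngGeo8 P Q β U μ (klFlowFrameU L M β U μ n) n ∧ IsoTupleL1AtV17F L M klEngGeo7 P β U μ n) :=
  Iff.rfl

end SlotDoors

/-- **Consumer form**: from any witness `E4FlowAt E u` (`0 ≤ E`, `u > 0`), at every well-formed `G` with `klE4TF ≤ G.cE4` (in particular `klEngGeo8`)
and every well-formed `Q`, under the v2 binders (`U ≤ klE4UF G P R Q cc` among the thresholds), conjunct 3 of stub (b):
`EngineFirstMoments L M G P Q β U μ (K_n) n`. -/
theorem engineFirstMoments_flow_of_e4FlowAt {E : ℝ} {u : GeoConsts → SplitConsts → RenConsts → EngConsts → ℝ → ℝ} (hE0 : 0 ≤ E)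
    (hu : ∀ G P R Q cc, 0 < u G P R Q cc) (hE : E4FlowAt E u)
    (G : GeoConsts) (hG : G.WF) (hcE4 : klE4TF ≤ G.cE4) (P : SplitConsts) (R : RenConsts) (Q : EngConsts) (cc : ℝ) (hP : P.WF) (hR : R.WF2)
    (hQ : Q.WF) (hcc : 0 < cc) (hcc6 : cc ≤ klEngC₃6 P R) (μ : ℝ) (hμ : μ ∈ klWindowC) (U : ℝ) (hU : 0 < U) (hUu : U ≤ klE4UF G P R Q cc)
    (β : ℝ) (hβ : klBetaMin ≤ β) (hβc : β ≤ Real.exp (cc / U ^ 2)) (L M : ℕ) [NeZero L] [NeZero M]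
    (hL : klEngL₃ β U ≤ L) (hM : klEngM₃ β U L ≤ M) (n : ℕ) (hn1 : 1 ≤ n) (hn : n ≤ nScales β + 1) (hreg : IsKLRegime U cc (-(n : ℤ)))
    (hhist : HistP klPredsV17F2 L M G P Q R β U μ 0 n) (hfr : FrameOK R U (nScales β) μ (klFlowFrameU L M β U μ n)) :
    EngineFirstMoments L M G P Q β U μ (klFlowFrameU L M β U μ n) n :=
  e4FlowAt_klE4Pack hE0 hu hE G hG hcE4 P R Q cc hP hR hQ hcc hcc6 μ hμ U hU hUu β hβ hβc L M hL hM n hn1 hn hreg hhist hfr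

/-- The same at `klEngGeo8` (any well-formed `Q`, e.g. `klEngQ8 P R` of v2). -/
theorem engineFirstMoments_flow_klEngGeo8 {E : ℝ} {u : GeoConsts → SplitConsts → RenConsts → EngConsts → ℝ → ℝ} (hE0 : 0 ≤ E)
    (hu : ∀ G P R Q cc, 0 < u G P R Q cc) (hE : E4FlowAt E u)
    (P : SplitConsts) (R : RenConsts) (Q : EngConsts) (cc : ℝ) (hP : P.WF) (hR : R.WF2) (hQ : Q.WF) (hcc : 0 < cc)
    (hcc6 : cc ≤ klEngC₃6 P R) (μ : ℝ) (hμ : μ ∈ klWindowC) (U : ℝ) (hU : 0 < U) (hUu : U ≤ klE4UF klEngGeo8 P R Q cc)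
    (β : ℝ) (hβ : klBetaMin ≤ β) (hβc : β ≤ Real.exp (cc / U ^ 2)) (L M : ℕ) [NeZero L] [NeZero M]
    (hL : klEngL₃ β U ≤ L) (hM : klEngM₃ β U L ≤ M) (n : ℕ) (hn1 : 1 ≤ n) (hn : n ≤ nScales β + 1) (hreg : IsKLRegime U cc (-(n : ℤ)))
    (hhist : HistP klPredsV17F2 L M klEngGeo8 P Q R β U μ 0 n) (hfr : FrameOK R U (nScales β) μ (klFlowFrameU L M β U μ n)) :
    EngineFirstMoments L M klEngGeo8 P Q β U μ (klFlowFrameU L M β U μ n) n :=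
  engineFirstMoments_flow_of_e4FlowAt hE0 hu hE klEngGeo8 klEngGeo8_wf klE4TF_le_klEngGeo8_cE4 P R Q cc hP hR hQ hcc hcc6 μ hμ U hU hUu β hβ
    hβc L M hL hM n hn1 hn hreg hhist hfr

end Summit.HubbardSuperconductivity.HubbardSuperconductivity.Theorems.EngineV8

end
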